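import Mathlib
import HarnessLib
import Literature.MeasureTheory.RandomSets.AvoidanceFunctional
import Summits.CriticalPhenomena.SAWScalingLimit.Theorems.SAWLoopLiftWernerDeterminationTopology

/-!
# Werner determination (route SAWLoopLift, item stmt-CriticalPhenomena-4851) — the surrounding events
in the Hausdorff hyperspace

Helper file (`--supports stmt-CriticalPhenomena-4851`). On the hyperspace `NonemptyCompacts ℂ` (Vietoris
= Hausdorff-metric topology, Borel σ-algebra as instance parameters, as in
`Literature.MeasureTheory.RandomSets.AvoidanceFunctional`) we study the events of the route item
`WernerDetermination`:

* the *exterior event* `{T | z ∉ T ∧ ¬ IsBounded (connectedComponentIn Tᶜ z)}` is OPEN (a union of miss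
  events of closed connected unbounded sets, by `not_isBounded_connectedComponentIn_iff`); hence the
  *surrounding event* `{T | z ∉ T ∧ IsBounded (connectedComponentIn Tᶜ z)}` and the events
  `{T | T ⊆ W ∧ z ∉ T ∧ IsBounded (connectedComponentIn Tᶜ z)}` (`W` open) of the item are Borel;
* these events, for `W` ranging over open sets without holes, form a π-system;
* Lindelöf reductions (the hyperspace is second countable): the event "`T` surrounds `z` and the compact
  connected set `Q` lies in the exterior of `T`" is a COUNTABLE union of generators, hence measurable for
  the σ-algebra generated by the π-system; and the event "`T` surrounds `z` and `Q` lies in the component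
  of `z`" is a countable union of events "`T` surrounds `z` and misses `K`" over compact connected
  `K ∋ z`.

No new definitions; the events are written out (local notation `around z inW W` in proofs only).
References: W. Werner, J. Amer. Math. Soc. 21 (2008), §3 (the σ-field generated by the events `U_A`);
I. Molchanov, *Theory of Random Sets* (2005), App. C.
-/

noncomputable section

namespace Summit.CriticalPhenomena.SAWScalingLimit.Theorems.WernerDetermination

open Set Metric Bornology Topology Filter TopologicalSpace MeasureTheory
open Literature.MeasureTheory.RandomSets (isOpen_setOf_disjoint_of_isClosed)

/-- The event "`T ⊆ W` and `T` surrounds `z`" of the route item (local notation). -/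
local notation3 "around " z " inW " W => {T : NonemptyCompacts ℂ | (T : Set ℂ) ⊆ W ∧ z ∉ (T : Set ℂ) ∧
  IsBounded (connectedComponentIn (T : Set ℂ)ᶜ z)}

/-- The π-system of such events over open sets `W` without holes (local notation). -/
local notation3 "piSys " z => {S : Set (NonemptyCompacts ℂ) | ∃ W : Set ℂ, IsOpen W ∧
  (∀ a ∈ Wᶜ, ¬ IsBounded (connectedComponentIn Wᶜ a)) ∧ S = around z inW W}

/-! ### The exterior event is open; the surrounding events are Borel -/

/-- **The exterior event is a union of miss events**: `z` is an exterior point of the compact `T` iff `T`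
misses some closed preconnected unbounded set containing `z`. [folklore] -/
theorem setOf_not_isBounded_eq_biUnion (z : ℂ) :
    {T : NonemptyCompacts ℂ | z ∉ (T : Set ℂ) ∧ ¬ IsBounded (connectedComponentIn (T : Set ℂ)ᶜ z)} =
      ⋃ F ∈ {F : Set ℂ | IsClosed F ∧ IsPreconnected F ∧ ¬ IsBounded F ∧ z ∈ F},
        {T : NonemptyCompacts ℂ | Disjoint (T : Set ℂ) F} := by
  ext T
  simp only [mem_setOf_eq, mem_iUnion, exists_prop]
  constructor
  · rintro ⟨hz, hnb⟩
    obtain ⟨F, hFc, hFp, hFb, hzF, hFT⟩ := (not_isBounded_connectedComponentIn_iff T.isCompact hz).1 hnb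
    exact ⟨F, ⟨hFc, hFp, hFb, hzF⟩, hFT.symm⟩
  · rintro ⟨F, ⟨hFc, hFp, hFb, hzF⟩, hTF⟩
    have hz : z ∉ (T : Set ℂ) := fun h => disjoint_left.1 hTF h hzF
    exact ⟨hz, (not_isBounded_connectedComponentIn_iff T.isCompact hz).2 ⟨F, hFc, hFp, hFb, hzF, hTF.symm⟩⟩

/-- **The exterior event `{T | z ∉ T, cc(Tᶜ, z) unbounded}` is open** in the hyperspace. [folklore] -/
theorem isOpen_setOf_not_isBounded (z : ℂ) :
    IsOpen {T : NonemptyCompacts ℂ | z ∉ (T : Set ℂ) ∧ ¬ IsBounded (connectedComponentIn (T : Set ℂ)ᶜ z)} := by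
  rw [setOf_not_isBounded_eq_biUnion]
  exact isOpen_biUnion fun F hF => isOpen_setOf_disjoint_of_isClosed hF.1

/-- The surrounding event is the difference of the open event `{T | z ∉ T}` and the exterior event.
[folklore] -/
theorem setOf_isBounded_eq_diff (z : ℂ) :
    {T : NonemptyCompacts ℂ | z ∉ (T : Set ℂ) ∧ IsBounded (connectedComponentIn (T : Set ℂ)ᶜ z)} =
      {T : NonemptyCompacts ℂ | (T : Set ℂ) ⊆ {z}ᶜ} \
        {T : NonemptyCompacts ℂ | z ∉ (T : Set ℂ) ∧ ¬ IsBounded (connectedComponentIn (T : Set ℂ)ᶜ z)} := by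
  ext T
  simp only [mem_setOf_eq, Set.mem_sdiff, subset_compl_singleton_iff, not_and, not_not]
  tauto

variable [MeasurableSpace (NonemptyCompacts ℂ)] [BorelSpace (NonemptyCompacts ℂ)]

/-- **The surrounding event is Borel.** [folklore] -/
theorem measurableSet_setOf_isBounded (z : ℂ) :
    MeasurableSet {T : NonemptyCompacts ℂ | z ∉ (T : Set ℂ) ∧
      IsBounded (connectedComponentIn (T : Set ℂ)ᶜ z)} := by
  rw [setOf_isBounded_eq_diff]
  exact (NonemptyCompacts.isOpen_subsets_of_isOpen isOpen_compl_singleton).measurableSet.diff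
    (isOpen_setOf_not_isBounded z).measurableSet

/-- **The events `{T ⊆ W, T surrounds z}` are Borel** for `W` open. [folklore] -/
theorem measurableSet_around (z : ℂ) {W : Set ℂ} (hW : IsOpen W) : MeasurableSet (around z inW W) := by
  have : (around z inW W) = {T : NonemptyCompacts ℂ | (T : Set ℂ) ⊆ W} ∩ {T : NonemptyCompacts ℂ |
      z ∉ (T : Set ℂ) ∧ IsBounded (connectedComponentIn (T : Set ℂ)ᶜ z)} := by
    ext T; simp only [mem_setOf_eq, mem_inter_iff]
  rw [this]
  exact (NonemptyCompacts.isOpen_subsets_of_isOpen hW).measurableSet.inter (measurableSet_setOf_isBounded z)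

/-- **The events of the route item are Borel**: `{T ⊆ U ∧ z ∉ T ∧ cc(Tᶜ, z) bounded ∧ ¬ T ⊆ V}` for
`U`, `V` open. [folklore] -/
theorem measurableSet_event (z : ℂ) {U V : Set ℂ} (hU : IsOpen U) (hV : IsOpen V) :
    MeasurableSet {T : NonemptyCompacts ℂ | (T : Set ℂ) ⊆ U ∧ z ∉ (T : Set ℂ) ∧
      IsBounded (connectedComponentIn (T : Set ℂ)ᶜ z) ∧ ¬ (T : Set ℂ) ⊆ V} := by
  have : {T : NonemptyCompacts ℂ | (T : Set ℂ) ⊆ U ∧ z ∉ (T : Set ℂ) ∧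
      IsBounded (connectedComponentIn (T : Set ℂ)ᶜ z) ∧ ¬ (T : Set ℂ) ⊆ V} =
      (around z inW U) \ {T : NonemptyCompacts ℂ | (T : Set ℂ) ⊆ V} := by
    ext T; simp only [mem_setOf_eq, Set.mem_sdiff]; tauto
  rw [this]
  exact (measurableSet_around z hU).diff (NonemptyCompacts.isOpen_subsets_of_isOpen hV).measurableSet

omit [MeasurableSpace (NonemptyCompacts ℂ)] [BorelSpace (NonemptyCompacts ℂ)] in
/-- Intersections of surrounding events: `around z W ∩ around z W' = around z (W ∩ W')`. [folklore] -/
theorem around_inter (z : ℂ) (W W' : Set ℂ) :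
    (around z inW W) ∩ (around z inW W') = around z inW (W ∩ W') := by
  ext T
  simp only [mem_inter_iff, mem_setOf_eq, subset_inter_iff]
  tauto

omit [MeasurableSpace (NonemptyCompacts ℂ)] [BorelSpace (NonemptyCompacts ℂ)] in
/-- **The surrounding events over open sets without holes form a π-system** (open sets without holes
are stable under intersection, `forall_not_isBounded_inter`). [folklore] -/
theorem isPiSystem_piSys (z : ℂ) : IsPiSystem (piSys z) := by
  rintro S ⟨W, hW, hWh, rfl⟩ S' ⟨W', hW', hWh', rfl⟩ -
  exact ⟨W ∩ W', hW.inter hW', forall_not_isBounded_inter hWh hWh', around_inter z W W'⟩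

omit [MeasurableSpace (NonemptyCompacts ℂ)] [BorelSpace (NonemptyCompacts ℂ)] in
/-- The generators are measurable for the generated σ-algebra (bookkeeping). [folklore] -/
theorem measurableSet_generateFrom_around (z : ℂ) {W : Set ℂ} (hW : IsOpen W)
    (hWh : ∀ a ∈ Wᶜ, ¬ IsBounded (connectedComponentIn Wᶜ a)) :
    MeasurableSet[MeasurableSpace.generateFrom (piSys z)] (around z inW W) :=
  MeasurableSpace.measurableSet_generateFrom ⟨W, hW, hWh, rfl⟩

/-- The generated σ-algebra is coarser than the Borel σ-algebra. [folklore] -/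
theorem generateFrom_piSys_le (z : ℂ) :
    MeasurableSpace.generateFrom (piSys z) ≤ ‹MeasurableSpace (NonemptyCompacts ℂ)› := by
  refine MeasurableSpace.generateFrom_le ?_
  rintro S ⟨W, hW, -, rfl⟩
  exact measurableSet_around z hW

/-! ### Lindelöf reductions -/

omit [MeasurableSpace (NonemptyCompacts ℂ)] [BorelSpace (NonemptyCompacts ℂ)] in
/-- **"`Q` lies in the exterior" as a union of generators.** For a nonempty compact preconnected `Q`, a
compact `T` surrounding `z` has `Q` in its exterior iff `T ⊆ Fᶜ` for some closed preconnected unbounded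
`F ⊇ Q` (then `Fᶜ` is an open set without holes). [folklore] -/
theorem setOf_exterior_eq_biUnion (z : ℂ) {Q : Set ℂ} (hQ : IsCompact Q) (hQp : IsPreconnected Q)
    (hQne : Q.Nonempty) :
    {T : NonemptyCompacts ℂ | (z ∉ (T : Set ℂ) ∧ IsBounded (connectedComponentIn (T : Set ℂ)ᶜ z)) ∧
      ∀ q ∈ Q, q ∉ (T : Set ℂ) ∧ ¬ IsBounded (connectedComponentIn (T : Set ℂ)ᶜ q)} =
      ⋃ F ∈ {F : Set ℂ | IsClosed F ∧ IsPreconnected F ∧ ¬ IsBounded F ∧ Q ⊆ F}, around z inW Fᶜ := by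
  ext T
  simp only [mem_setOf_eq, mem_iUnion, exists_prop]
  constructor
  · rintro ⟨⟨hz, hzb⟩, hQT⟩
    obtain ⟨q₀, hq₀⟩ := hQne
    obtain ⟨hq₀T, hq₀b⟩ := hQT q₀ hq₀
    obtain ⟨F₀, hF₀c, hF₀p, hF₀b, hq₀F₀, hF₀T⟩ :=
      (not_isBounded_connectedComponentIn_iff T.isCompact hq₀T).1 hq₀b
    refine ⟨Q ∪ F₀, ⟨hQ.isClosed.union hF₀c, hQp.union q₀ hq₀ hq₀F₀ hF₀p,
      fun h => hF₀b (h.subset subset_union_right), subset_union_left⟩, ?_, hz, hzb⟩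
    intro x hxT hxF
    rcases hxF with hxQ | hxF₀
    · exact (hQT x hxQ).1 hxT
    · exact disjoint_left.1 hF₀T hxF₀ hxT
  · rintro ⟨F, ⟨hFc, hFp, hFb, hQF⟩, hTF, hz, hzb⟩
    refine ⟨⟨hz, hzb⟩, fun q hq => ?_⟩
    have hqT : q ∉ (T : Set ℂ) := fun h => hTF h (hQF hq)
    exact ⟨hqT, (not_isBounded_connectedComponentIn_iff T.isCompact hqT).2
      ⟨F, hFc, hFp, hFb, hQF hq, disjoint_left.2 fun x hxF hxT => hTF hxT hxF⟩⟩

omit [MeasurableSpace (NonemptyCompacts ℂ)] [BorelSpace (NonemptyCompacts ℂ)] in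
/-- **The exterior event of a compact connected set is measurable for the generated σ-algebra**: the
union of open events `{T ⊆ Fᶜ}` over the (uncountable) family of closed connected unbounded `F ⊇ Q` has
a countable subfamily with the same union (the hyperspace is second countable), and each
`around z Fᶜ` is a generator. [folklore] -/
theorem measurableSet_generateFrom_exterior (z : ℂ) {Q : Set ℂ} (hQ : IsCompact Q)
    (hQp : IsPreconnected Q) (hQne : Q.Nonempty) :
    MeasurableSet[MeasurableSpace.generateFrom (piSys z)]
      {T : NonemptyCompacts ℂ | (z ∉ (T : Set ℂ) ∧ IsBounded (connectedComponentIn (T : Set ℂ)ᶜ z)) ∧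
        ∀ q ∈ Q, q ∉ (T : Set ℂ) ∧ ¬ IsBounded (connectedComponentIn (T : Set ℂ)ᶜ q)} := by
  set 𝓕 : Set (Set ℂ) := {F : Set ℂ | IsClosed F ∧ IsPreconnected F ∧ ¬ IsBounded F ∧ Q ⊆ F} with h𝓕
  -- countable subfamily with the same union of the open events `{T ⊆ Fᶜ}`
  obtain ⟨C, hCc, hCU⟩ := TopologicalSpace.isOpen_iUnion_countable
    (fun F : 𝓕 => {T : NonemptyCompacts ℂ | (T : Set ℂ) ⊆ (F : Set ℂ)ᶜ})
    (fun F => NonemptyCompacts.isOpen_subsets_of_isOpen F.2.1.isOpen_compl)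
  have key : {T : NonemptyCompacts ℂ | (z ∉ (T : Set ℂ) ∧ IsBounded (connectedComponentIn (T : Set ℂ)ᶜ z)) ∧
      ∀ q ∈ Q, q ∉ (T : Set ℂ) ∧ ¬ IsBounded (connectedComponentIn (T : Set ℂ)ᶜ q)} =
      ⋃ F ∈ C, around z inW (F : Set ℂ)ᶜ := by
    rw [setOf_exterior_eq_biUnion z hQ hQp hQne]
    ext T
    simp only [mem_iUnion, mem_setOf_eq, exists_prop]
    constructor
    · rintro ⟨F, hF, hTF, hz, hzb⟩
      have hmem : T ∈ ⋃ F' : 𝓕, {T : NonemptyCompacts ℂ | (T : Set ℂ) ⊆ (F' : Set ℂ)ᶜ} :=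
        mem_iUnion.2 ⟨⟨F, hF⟩, hTF⟩
      rw [← hCU] at hmem
      simp only [mem_iUnion, mem_setOf_eq, exists_prop] at hmem
      obtain ⟨F', hF'C, hTF'⟩ := hmem
      exact ⟨F', hF'C, hTF', hz, hzb⟩
    · rintro ⟨F', -, hTF', hz, hzb⟩
      exact ⟨F', F'.2, hTF', hz, hzb⟩
  rw [key]
  haveI : Countable C := hCc.to_subtype
  refine MeasurableSet.biUnion hCc fun F _ => ?_
  exact MeasurableSpace.measurableSet_generateFrom
    ⟨(F : Set ℂ)ᶜ, F.2.1.isOpen_compl, forall_not_isBounded_compl_compl F.2.2.1 F.2.2.2.1, rfl⟩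

omit [MeasurableSpace (NonemptyCompacts ℂ)] [BorelSpace (NonemptyCompacts ℂ)] in
/-- **"`Q` lies in the component of `z`" as a union of miss events.** For a nonempty compact `Q`, a
compact `T` surrounding `z` has `Q` inside the component of `z` in `Tᶜ` iff `T` misses some compact
preconnected `K ∋ z` with `Q ⊆ K` (a path from `z` to `Q` inside the component, together with `Q`, when
`Q` is preconnected). [folklore] -/
theorem setOf_interior_eq_biUnion (z : ℂ) {Q : Set ℂ} (hQ : IsCompact Q) (hQp : IsPreconnected Q)
    (hQne : Q.Nonempty) :
    {T : NonemptyCompacts ℂ | (z ∉ (T : Set ℂ) ∧ IsBounded (connectedComponentIn (T : Set ℂ)ᶜ z)) ∧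
      Q ⊆ connectedComponentIn (T : Set ℂ)ᶜ z} =
      ⋃ K ∈ {K : Set ℂ | IsCompact K ∧ IsPreconnected K ∧ z ∈ K ∧ Q ⊆ K},
        {T : NonemptyCompacts ℂ | (z ∉ (T : Set ℂ) ∧ IsBounded (connectedComponentIn (T : Set ℂ)ᶜ z)) ∧
          Disjoint (T : Set ℂ) K} := by
  ext T
  simp only [mem_setOf_eq, mem_iUnion, exists_prop]
  constructor
  · rintro ⟨⟨hz, hzb⟩, hQT⟩
    obtain ⟨q₀, hq₀⟩ := hQne
    have hopen : IsOpen (connectedComponentIn (T : Set ℂ)ᶜ z) :=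
      T.isCompact.isClosed.isOpen_compl.connectedComponentIn
    have hpc : IsPathConnected (connectedComponentIn (T : Set ℂ)ᶜ z) :=
      (hopen.isConnected_iff_isPathConnected).1 (isConnected_connectedComponentIn_iff.2 hz)
    obtain ⟨γ, hγ⟩ := hpc.joinedIn z (mem_connectedComponentIn hz) q₀ (hQT hq₀)
    refine ⟨range γ ∪ Q, ⟨(isCompact_range γ.continuous).union hQ,
      (isPreconnected_range γ.continuous).union q₀ ⟨1, γ.target⟩ hq₀ hQp, Or.inl ⟨0, γ.source⟩,
      subset_union_right⟩, ⟨hz, hzb⟩, ?_⟩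
    rw [disjoint_left]
    rintro x hxT (⟨t, rfl⟩ | hxQ)
    · exact connectedComponentIn_subset _ _ (hγ t) hxT
    · exact connectedComponentIn_subset _ _ (hQT hxQ) hxT
  · rintro ⟨K, ⟨-, hKp, hzK, hQK⟩, ⟨hz, hzb⟩, hTK⟩
    refine ⟨⟨hz, hzb⟩, hQK.trans ?_⟩
    exact hKp.subset_connectedComponentIn hzK (fun x hxK hxT => disjoint_left.1 hTK hxT hxK)

omit [MeasurableSpace (NonemptyCompacts ℂ)] [BorelSpace (NonemptyCompacts ℂ)] in
/-- **Countable form**: the event "`T` surrounds `z` and `Q ⊆ cc(Tᶜ, z)`" is a COUNTABLE union of events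
"`T` surrounds `z` and misses `K`" over compact preconnected `K ∋ z` containing `Q` (Lindelöf: the miss
events of compact sets are open in the hyperspace). [folklore] -/
theorem exists_countable_setOf_interior_eq (z : ℂ) {Q : Set ℂ} (hQ : IsCompact Q) (hQp : IsPreconnected Q)
    (hQne : Q.Nonempty) :
    ∃ C : Set (Set ℂ), C.Countable ∧ C ⊆ {K : Set ℂ | IsCompact K ∧ IsPreconnected K ∧ z ∈ K ∧ Q ⊆ K} ∧
      {T : NonemptyCompacts ℂ | (z ∉ (T : Set ℂ) ∧ IsBounded (connectedComponentIn (T : Set ℂ)ᶜ z)) ∧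
        Q ⊆ connectedComponentIn (T : Set ℂ)ᶜ z} =
        ⋃ K ∈ C, {T : NonemptyCompacts ℂ | (z ∉ (T : Set ℂ) ∧
          IsBounded (connectedComponentIn (T : Set ℂ)ᶜ z)) ∧ Disjoint (T : Set ℂ) K} := by
  set 𝒦 : Set (Set ℂ) := {K : Set ℂ | IsCompact K ∧ IsPreconnected K ∧ z ∈ K ∧ Q ⊆ K} with h𝒦
  obtain ⟨C, hCc, hCU⟩ := TopologicalSpace.isOpen_iUnion_countable
    (fun K : 𝒦 => {T : NonemptyCompacts ℂ | Disjoint (T : Set ℂ) (K : Set ℂ)})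
    (fun K => isOpen_setOf_disjoint_of_isClosed K.2.1.isClosed)
  refine ⟨(fun K : 𝒦 => (K : Set ℂ)) '' C, hCc.image _, ?_, ?_⟩
  · rintro _ ⟨K, -, rfl⟩
    exact K.2
  · rw [setOf_interior_eq_biUnion z hQ hQp hQne, biUnion_image]
    ext T
    simp only [mem_iUnion, mem_setOf_eq, exists_prop]
    constructor
    · rintro ⟨K, hK, hsurr, hTK⟩
      have hmem : T ∈ ⋃ K' : 𝒦, {T : NonemptyCompacts ℂ | Disjoint (T : Set ℂ) (K' : Set ℂ)} :=
        mem_iUnion.2 ⟨⟨K, hK⟩, hTK⟩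
      rw [← hCU] at hmem
      simp only [mem_iUnion, mem_setOf_eq, exists_prop] at hmem
      obtain ⟨K', hK'C, hTK'⟩ := hmem
      exact ⟨K', hK'C, hsurr, hTK'⟩
    · rintro ⟨K', -, hsurr, hTK'⟩
      exact ⟨K', K'.2, hsurr, hTK'⟩

end Summit.CriticalPhenomena.SAWScalingLimit.Theorems.WernerDetermination
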